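import Literature.GroupTheory.CombinatorialGroupTheory.QuadraticWordsVertexDefs
import Literature.GroupTheory.CombinatorialGroupTheory.PermutationCycleSurgery
import Literature.GroupTheory.CombinatorialGroupTheory.QuadraticWordsGathering
import HarnessLib

/-!
# Vertices of an alternating quadratic word: connected sums, the interlinking oracle, block words

Topic `Literature/GroupTheory/CombinatorialGroupTheory`; continues `QuadraticWordsVertexDefs.lean`
(the vertex permutation `vertexPerm w = formPerm w ∘ bar` of a word and one-vertex words, ZVC
§1.3).  Proved here, by the cycle surgery of `PermutationCycleSurgery.lean`:

* `vertexPerm_append_eq`, `VertexTransitive.append`, `VertexTransitive.of_append_left/right` — for CLOSED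
  words `M`, `N` (each containing the partners of its letters) the vertex permutation of `M ++ N`
  is the disjoint union of those of `M`, `N` followed by one transposition, so `M ++ N` is
  one-vertex iff both are (connected sum of the two surfaces at a vertex);
* `VertexTransitive.exists_unpartnered` — in a one-vertex word every pair `p … p̄` encloses a letter
  whose partner is not enclosed: every edge is interlinked with another one (the input of the
  handle gathering of ZVC 3.2.4, replacing nondegeneracy of the intersection form);
* `vertexTransitive_blockWord`, `vertexTransitive_blocksWord`, `vertexTransitive_surfaceWordStd` — commutator blocks,
  their products `∏ [x_{qᵢ}, x_{zᵢ}]`, and the standard surface word are one-vertex words.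

## References

* H. Zieschang, E. Vogt, H.-D. Coldewey, *Surfaces and Planar Discontinuous Groups*, LNM 835,
  Springer 1980, §1.3, §3.2 (3.2.4). [ZieschangVogtColdewey1980]
-/

namespace Literature.GroupTheory.CombinatorialGroupTheory

open List Equiv Equiv.Perm

section Words

variable {ι : Type*} [DecidableEq ι]

/-! ### Closed blocks: connected sum at a vertex -/

/-- For closed `M`, `N` with `M ++ N` duplicate-free and both nonempty, the vertex permutation of
`M ++ N` is the disjoint union of those of `M` and `N` followed by the transposition of the
partners of the two last letters. [cite: ZieschangVogtColdewey1980, 3.1.2] -/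
theorem vertexPerm_append_eq {M N : List (ι × Bool)} (hd : (M ++ N).Nodup) (hM : M ≠ []) (hN : N ≠ []) :
    vertexPerm (M ++ N) =
      (M.formPerm * N.formPerm * barPerm) * swap (bar (M.getLast hM)) (bar (N.getLast hN)) := by
  rw [vertexPerm, formPerm_append_eq M N hd hM hN]
  have e : swap (bar (M.getLast hM)) (bar (N.getLast hN)) =
      barPerm * swap (M.getLast hM) (N.getLast hN) * barPerm⁻¹ := by
    rw [← swap_apply_apply]; rfl
  have hb : (barPerm : Perm (ι × Bool)) * barPerm = 1 :=
    mul_eq_one_iff_eq_inv.2 barPerm_inv.symm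
  rw [e, barPerm_inv]
  simp only [← mul_assoc]
  rw [mul_assoc (M.formPerm * N.formPerm) barPerm barPerm, hb, mul_one]

/-- The "disjoint union" permutation `formPerm M * formPerm N * bar` restricted to the letters
of the closed word `M` is the vertex permutation of `M`. [cite: ZieschangVogtColdewey1980, 3.1.2] -/
theorem union_apply_of_mem_left {M N : List (ι × Bool)} (hd : (M ++ N).Nodup) (hM : Closed M)
    {x : ι × Bool} (hx : x ∈ M) :
    (M.formPerm * N.formPerm * (barPerm : Perm (ι × Bool))) x = vertexPerm M x := by
  rw [Perm.mul_apply, Perm.mul_apply, barPerm_apply, vertexPerm_apply,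
    formPerm_apply_of_notMem fun h => (disjoint_of_nodup_append hd) (hM x hx) h]

/-- … and restricted to the letters of the closed word `N` it is the vertex permutation of `N`.
[cite: ZieschangVogtColdewey1980, 3.1.2] -/
theorem union_apply_of_mem_right {M N : List (ι × Bool)} (hd : (M ++ N).Nodup) (hN : Closed N)
    {x : ι × Bool} (hx : x ∈ N) :
    (M.formPerm * N.formPerm * (barPerm : Perm (ι × Bool))) x = vertexPerm N x := by
  rw [Perm.mul_apply, Perm.mul_apply, barPerm_apply, vertexPerm_apply]
  exact formPerm_apply_of_notMem fun h =>
    (disjoint_of_nodup_append hd) h (formPerm_apply_mem_of_mem (hN x hx))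

/-- **Connected sum**: the concatenation of two closed one-vertex words is one-vertex.
[cite: ZieschangVogtColdewey1980, §1.3] -/
theorem VertexTransitive.append [Fintype ι] {M N : List (ι × Bool)} (h₁ : VertexTransitive M) (h₂ : VertexTransitive N)
    (hd : (M ++ N).Nodup) (hM : Closed M) (hN : Closed N) : VertexTransitive (M ++ N) := by
  rcases eq_or_ne M [] with rfl | hM0
  · simpa using h₂
  rcases eq_or_ne N [] with rfl | hN0
  · simpa using h₁
  set ρ : Perm (ι × Bool) := M.formPerm * N.formPerm * barPerm with hρ
  set u := bar (M.getLast hM0)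
  set v := bar (N.getLast hN0)
  have huM : u ∈ M := hM _ (getLast_mem hM0)
  have hvN : v ∈ N := hN _ (getLast_mem hN0)
  have hρM : ∀ x ∈ M, ρ x ∈ M := fun x hx => by
    rw [hρ, union_apply_of_mem_left hd hM hx]; exact hM.vertexPerm_apply_mem hx
  have hρN : ∀ x ∈ N, ρ x ∈ N := fun x hx => by
    rw [hρ, union_apply_of_mem_right hd hN hx]; exact hN.vertexPerm_apply_mem hx
  have huv : u ≠ v := fun h => (disjoint_of_nodup_append hd) huM (h ▸ hvN)
  have hτ := vertexPerm_append_eq hd hM0 hN0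
  have key : ∀ x, ρ.SameCycle u x ∨ ρ.SameCycle v x → (vertexPerm (M ++ N)).SameCycle u x := by
    intro x hx
    refine sameCycle_of_swap_merge (ρ := ρ) (u := u) (v := v) ?_ ?_ ?_ ?_ hx
    · rw [hτ, Perm.mul_apply, swap_apply_left]
    · rw [hτ, Perm.mul_apply, swap_apply_right]
    · intro y h1 h2; rw [hτ, Perm.mul_apply, swap_apply_of_ne_of_ne h1 h2]
    · intro h
      exact (disjoint_of_nodup_append hd) (SameCycle.mem_of_forall_apply_mem hρM huM h) hvN
  have hSM : ∀ y ∈ {y | y ∈ M}, vertexPerm M y ∈ {y | y ∈ M} := fun y hy => hM.vertexPerm_apply_mem hy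
  have hSN : ∀ y ∈ {y | y ∈ N}, vertexPerm N y ∈ {y | y ∈ N} := fun y hy => hN.vertexPerm_apply_mem hy
  have hgM : ∀ y ∈ {y | y ∈ M}, vertexPerm M y = ρ y := fun y hy =>
    (union_apply_of_mem_left hd hM hy).symm
  have hgN : ∀ y ∈ {y | y ∈ N}, vertexPerm N y = ρ y := fun y hy =>
    (union_apply_of_mem_right hd hN hy).symm
  have hall : ∀ x ∈ M ++ N, (vertexPerm (M ++ N)).SameCycle u x := by
    intro x hx
    rcases mem_append.1 hx with hx | hx
    · exact key x (Or.inl (SameCycle.of_forall_apply_eq hSM hgM huM (h₁ u huM x hx)))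
    · exact key x (Or.inr (SameCycle.of_forall_apply_eq hSN hgN hvN (h₂ v hvN x hx)))
  exact fun x hx y hy => (hall x hx).symm.trans (hall y hy)

/-- **Splitting off a closed block**: if `M ++ N` is one-vertex with `M`, `N` closed, then `M`
is one-vertex. [cite: ZieschangVogtColdewey1980, §1.3] -/
theorem VertexTransitive.of_append_left [Fintype ι] {M N : List (ι × Bool)} (h : VertexTransitive (M ++ N))
    (hd : (M ++ N).Nodup) (hM : Closed M) (hN : Closed N) : VertexTransitive M := by
  rcases eq_or_ne M [] with rfl | hM0
  · exact vertexTransitive_nil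
  rcases eq_or_ne N [] with rfl | hN0
  · simpa using h
  set ρ : Perm (ι × Bool) := M.formPerm * N.formPerm * barPerm with hρ
  set u := bar (M.getLast hM0)
  set v := bar (N.getLast hN0)
  have huM : u ∈ M := hM _ (getLast_mem hM0)
  have hvN : v ∈ N := hN _ (getLast_mem hN0)
  have hρM : ∀ x ∈ {x | x ∈ M}, ρ x ∈ {x | x ∈ M} := fun x hx => by
    simp only [Set.mem_setOf_eq] at hx ⊢
    rw [hρ, union_apply_of_mem_left hd hM hx]; exact hM.vertexPerm_apply_mem hx
  have hρN : ∀ x ∈ {x | x ∈ N}, ρ x ∈ {x | x ∈ N} := fun x hx => by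
    simp only [Set.mem_setOf_eq] at hx ⊢
    rw [hρ, union_apply_of_mem_right hd hN hx]; exact hN.vertexPerm_apply_mem hx
  have hPQ : Disjoint {x | x ∈ M} {x | x ∈ N} :=
    Set.disjoint_left.2 fun x hx hx' => (disjoint_of_nodup_append hd) hx hx'
  have hτ := vertexPerm_append_eq hd hM0 hN0
  have key : ∀ x ∈ M, ρ.SameCycle u x := by
    intro x hx
    refine sameCycle_of_swap_split (ρ := ρ) (τ := vertexPerm (M ++ N)) (u := u) (v := v)
      ?_ ?_ ?_ hρM hρN hPQ huM hvN hx (h u (mem_append_left _ huM) x (mem_append_left _ hx))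
    · rw [hτ, Perm.mul_apply, swap_apply_left]
    · rw [hτ, Perm.mul_apply, swap_apply_right]
    · intro y h1 h2; rw [hτ, Perm.mul_apply, swap_apply_of_ne_of_ne h1 h2]
  have hall : ∀ x ∈ M, (vertexPerm M).SameCycle u x := fun x hx =>
    SameCycle.of_forall_apply_eq (S := {x | x ∈ M}) hρM
      (fun y hy => union_apply_of_mem_left hd hM hy) huM (key x hx)
  exact fun x hx y hy => (hall x hx).symm.trans (hall y hy)

/-- If `M ++ N` is one-vertex with `M`, `N` closed, then `N` is one-vertex. [cite: ZieschangVogtColdewey1980, 3.1.2] -/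
theorem VertexTransitive.of_append_right [Fintype ι] {M N : List (ι × Bool)} (h : VertexTransitive (M ++ N))
    (hd : (M ++ N).Nodup) (hM : Closed M) (hN : Closed N) : VertexTransitive N :=
  ((vertexTransitive_append_comm hd).1 h).of_append_left (hd.perm perm_append_comm) hN hM

/-! ### The interlinking oracle -/

/-- **In a one-vertex word every pair is interlinked**: if `w = W₁ p T p̄ W₂` is one-vertex
(and duplicate-free), some letter of `T` has its partner outside `T` — otherwise the corners in
front of the letters of `T` and of `p̄` would form a vertex of their own.  This is the input
"some symbol `z` occurs exactly once between `p` and `p̄`" of the handle gathering of ZVC 3.2.4.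
[cite: ZieschangVogtColdewey1980, 3.2.4 (proof)] -/
theorem VertexTransitive.exists_unpartnered [Fintype ι] {w W₁ T W₂ : List (ι × Bool)} {q : ι} {s : Bool}
    (h : VertexTransitive w) (hd : w.Nodup) (hw : w = W₁ ++ (q, s) :: (T ++ (q, !s) :: W₂)) :
    ∃ x ∈ T, bar x ∉ T := by
  by_contra hall
  push Not at hall
  subst hw
  set w := W₁ ++ (q, s) :: (T ++ (q, !s) :: W₂) with hwdef
  have hqs : ((q, s) : ι × Bool) ≠ (q, !s) := fun e => by
    have := congrArg Prod.snd e; cases s <;> simp at this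
  have hqT : (q, s) ∉ T := fun hT => by
    have : ((q, s) :: (T ++ (q, !s) :: W₂)).Nodup := (nodup_append.1 hd).2.1
    exact (nodup_cons.1 this).1 (mem_append_left _ hT)
  -- the closed set of corners
  set C : Set (ι × Bool) := {x | x ∈ T ∨ x = (q, !s)} with hC
  have hstable : ∀ x ∈ C, vertexPerm w x ∈ C := by
    rintro x (hx | rfl)
    · -- a letter of `T`: its partner is in `T`, followed by a letter of `T` or by `p̄`
      have hb : bar x ∈ T := hall x hx
      rw [vertexPerm_apply]
      by_cases hl : ∀ hT : T ≠ [], bar x ≠ T.getLast hT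
      · obtain ⟨T₁, x', T₂, hTx⟩ := exists_split_succ hb hl
        have ew : w = (W₁ ++ (q, s) :: T₁) ++ bar x :: x' :: (T₂ ++ (q, !s) :: W₂) := by
          rw [hwdef, hTx]; simp
        rw [ew, formPerm_apply_mid _ _ _ _ (by rw [← ew]; exact hd)]
        exact Or.inl (by rw [hTx]; simp)
      · push Not at hl
        obtain ⟨hT, hxl⟩ := hl
        set Tl := T.getLast hT with hTl
        set TD := T.dropLast with hTD
        have hTDl : TD ++ [Tl] = T := dropLast_append_getLast hT
        have ew : w = (W₁ ++ (q, s) :: TD) ++ bar x :: (q, !s) :: W₂ := by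
          rw [hwdef, ← hTDl, hxl]; simp
        rw [ew, formPerm_apply_mid _ _ _ _ (by rw [← ew]; exact hd)]
        exact Or.inr rfl
    · -- the corner in front of `p̄` goes to the corner behind `p`
      rw [vertexPerm_apply, bar_mk, Bool.not_not]
      rcases T with _ | ⟨t, T'⟩
      · have ew : w = W₁ ++ (q, s) :: (q, !s) :: W₂ := by rw [hwdef]; simp
        rw [ew, formPerm_apply_mid _ _ _ _ (by rw [← ew]; exact hd)]
        exact Or.inr rfl
      · have ew : w = W₁ ++ (q, s) :: t :: (T' ++ (q, !s) :: W₂) := by rw [hwdef]; simp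
        rw [ew, formPerm_apply_mid _ _ _ _ (by rw [← ew]; exact hd)]
        exact Or.inl mem_cons_self
  have hq' : ((q, !s) : ι × Bool) ∈ w := by simp [hwdef]
  have hq : ((q, s) : ι × Bool) ∈ w := by simp [hwdef]
  have hmem : ((q, s) : ι × Bool) ∈ C :=
    SameCycle.mem_of_forall_apply_mem hstable (Or.inr rfl) (h _ hq' _ hq)
  rcases hmem with hT | he
  · exact hqT hT
  · exact hqs he

/-! ### Block words are one-vertex -/

/-- A commutator block `[x_q^{(s)}, x_z^{(σ)}]` (`q ≠ z`) is a one-vertex word (the torus).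
[cite: ZieschangVogtColdewey1980, §1.3] -/
theorem vertexTransitive_blockWord {q z : ι} (hqz : q ≠ z) (s σ : Bool) :
    VertexTransitive (Block.word ⟨q, s, z, σ⟩) := by
  have hzq : z ≠ q := fun e => hqz e.symm
  have hd : (Block.word ⟨q, s, z, σ⟩).Nodup := by
    simp [Block.word, hqz, hzq]
  -- the vertex permutation: p ↦ ζ̄ ↦ p̄ ↦ ζ ↦ p
  have e1 : vertexPerm (Block.word ⟨q, s, z, σ⟩) (q, s) = (z, !σ) := by
    rw [vertexPerm_apply, bar_mk]
    exact formPerm_apply_mid [(q, s), (z, σ)] [] (q, !s) (z, !σ) (by simpa [Block.word] using hd)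
  have e2 : vertexPerm (Block.word ⟨q, s, z, σ⟩) (z, !σ) = (q, !s) := by
    rw [vertexPerm_apply, bar_mk, Bool.not_not]
    exact formPerm_apply_mid [(q, s)] [(z, !σ)] (z, σ) (q, !s) (by simpa [Block.word] using hd)
  have e3 : vertexPerm (Block.word ⟨q, s, z, σ⟩) (q, !s) = (z, σ) := by
    rw [vertexPerm_apply, bar_mk, Bool.not_not]
    exact formPerm_apply_mid [] [(q, !s), (z, !σ)] (q, s) (z, σ) (by simpa [Block.word] using hd)
  set φ := vertexPerm (Block.word ⟨q, s, z, σ⟩)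
  have h1 : φ.SameCycle (q, s) (z, !σ) := by
    rw [← e1]; exact (sameCycle_apply_right (f := φ)).2 SameCycle.rfl
  have h2 : φ.SameCycle (q, s) (q, !s) := by
    rw [← e2]; exact (sameCycle_apply_right (f := φ)).2 h1
  have h3 : φ.SameCycle (q, s) (z, σ) := by
    rw [← e3]; exact (sameCycle_apply_right (f := φ)).2 h2
  have hall : ∀ x ∈ Block.word ⟨q, s, z, σ⟩, φ.SameCycle (q, s) x := by
    intro x hx
    simp only [Block.word, mem_cons, not_mem_nil, or_false] at hx
    rcases hx with rfl | rfl | rfl | rfl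
    · exact SameCycle.rfl
    · exact h3
    · exact h2
    · exact h1
  exact fun x hx y hy => (hall x hx).symm.trans (hall y hy)

omit [DecidableEq ι] in
/-- Block words are closed. [cite: ZieschangVogtColdewey1980, 3.1.2] -/
theorem closed_blocksWord (bs : List (Block ι)) : Closed (blocksWord bs) :=
  fun _ hx => partner_mem_blocksWord hx

/-- **A product of commutator blocks is a one-vertex word** (connected sum of tori).
[cite: ZieschangVogtColdewey1980, §1.3] -/
theorem vertexTransitive_blocksWord [Fintype ι] :
    ∀ (bs : List (Block ι)), (blocksWord bs).Nodup → VertexTransitive (blocksWord bs)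
  | [], _ => by simpa [blocksWord] using (vertexTransitive_nil (ι := ι))
  | b :: bs, hd => by
    have e : blocksWord (b :: bs) = b.word ++ blocksWord bs := by
      rw [← singleton_append, blocksWord_append, blocksWord_singleton]
    rw [e] at hd ⊢
    have hqz : b.q ≠ b.z := by
      intro h
      have hb : b.word.Nodup := (nodup_append.1 hd).1
      have : ((b.q, b.s) : ι × Bool) ≠ (b.z, b.σ) ∧ ((b.q, b.s) : ι × Bool) ≠ (b.z, !b.σ) := by
        simp only [Block.word, nodup_cons, mem_cons, not_mem_nil, or_false, not_or] at hb
        exact ⟨hb.1.1, hb.1.2.2⟩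
      rcases this with ⟨h1, h2⟩
      cases hs : b.s <;> cases hσ : b.σ <;> simp_all
    obtain ⟨q, s, z, σ⟩ := b
    exact (vertexTransitive_blockWord hqz s σ).append (vertexTransitive_blocksWord bs (nodup_append.1 hd).2.1) hd
      (closed_blocksWord [⟨q, s, z, σ⟩] |>.of_perm (by simp [blocksWord])) (closed_blocksWord bs)

/-- The standard surface word `∏ [aᵢ, bᵢ]` is the block word of the standard handles. [cite: ZieschangVogtColdewey1980, 3.1.2] -/
theorem surfaceWordStd_eq_blocksWord (g : ℕ) :
    surfaceWordStd g = blocksWord ((finRange g).map fun i => (⟨(i, false), true, (i, true), true⟩ :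
      Block (Fin g × Bool))) := by
  simp [surfaceWordStd, blocksWord, flatMap_map, Block.word]

/-- **The standard surface word is a one-vertex word.** [cite: ZieschangVogtColdewey1980, §1.3] -/
theorem vertexTransitive_surfaceWordStd (g : ℕ) : VertexTransitive (surfaceWordStd g) := by
  rw [surfaceWordStd_eq_blocksWord]
  exact vertexTransitive_blocksWord _ (surfaceWordStd_eq_blocksWord g ▸ nodup_surfaceWordStd g)

end Words

end Literature.GroupTheory.CombinatorialGroupTheory
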